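import Summits.FinalStateConjecture.FinalStateConjecture.Theses.PhaseMixingCapture
import Literature.Geometry.Lorentzian.AsymptoticallyFlatCompleteness

/-!
# `WeakCosmicCensorshipMGHD` (crux `stmt-FinalStateConjecture-9952`): the completeness clause of
# admissibility is redundant

Support file of the crux disprover (cdisprove seat, cycle 2), `sorry`-free, no definitions, no
named facts. On a connected Hausdorff second-countable `3`-manifold the clause `D.IsComplete` of
Christodoulou's admissible class `admissibleVacuumData Σ` FOLLOWS from the other clauses: a datum
with a sole, strongly asymptotically flat end is geodesically complete — the tree's
`isComplete_of_isSoleEnd_holds` (`AsymptoticallyFlatCompleteness.lean`, Gordon's criterion applied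
to the smoothed coordinate radius of the end). Hence the admissible class equals the class cut out
by the vacuum constraints and the sole-SAF-end clause alone (`admissibleVacuumData_eq_of_t2`), and
the crux implies (indeed is equivalent to) its version with the completeness clause deleted
(`wccWithoutComplete_of_wcc`; the converse is the same rewriting). For the load-bearing analysis of
the crux: `IsComplete` is NOT load-bearing — in contrast with the vacuum-constraint clause
(`ConstraintsLoadBearing.lean`) and the maximality clause (`TruncatedMinkowski.lean`).

## References

* W. B. Gordon, Proc. Amer. Math. Soc. 37 (1973) 221–225, Theorem.
* R. Schoen, S.-T. Yau, Comm. Math. Phys. 65 (1979), §1.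
* D. Christodoulou, CQG 16 (1999) A23, p. A24 (the admissible class).
-/

noncomputable section

open Bundle TopologicalSpace Manifold Set Function Filter
open scoped ContDiff Topology

namespace Summit.FinalStateConjecture.FinalStateConjecture.Theorems.WeakCosmicCensorshipMGHD.Negative

open Literature.Geometry.Lorentzian
open Summit.FinalStateConjecture.FinalStateConjecture.Theses.PhaseMixingCapture (WeakCosmicCensorshipMGHD)

section Complete

variable {X : Type} [TopologicalSpace X] [ChartedSpace E3 X] [IsManifold (𝓡 3) ∞ X] [T2Space X]
  [SecondCountableTopology X] [ConnectedSpace X]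

/-- **A datum with a sole strongly asymptotically flat end is complete** (on a connected Hausdorff
second-countable `3`-manifold): the Dafermos–Rodnianski class is
`IsStronglyAsymptoticallyFlatWith e D M 1 2 2 1`, and `isComplete_of_isSoleEnd_holds` applies with
`β = 1 ≥ 0`. [cite: Gordon1973, Theorem] -/
theorem isComplete_of_isSoleEnd_of_isStronglyAsymptoticallyFlatDR {D : InitialDataSet (𝓡 3) X}
    [D.metric.HasLeviCivita] {e : AFEnd X} {M : ℝ} (hsole : e.IsSoleEnd)
    (hSAF : e.IsStronglyAsymptoticallyFlatDR D M) : D.IsComplete :=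
  isComplete_of_isSoleEnd_holds X D e M 1 2 2 1 zero_le_one hSAF hsole

/-- **The completeness clause of admissibility is redundant**: on a connected Hausdorff
second-countable `3`-manifold, `admissibleVacuumData X` is the class of smooth solutions of the
vacuum constraints possessing a sole strongly asymptotically flat end.
[cite: Christodoulou1999, p. A24] -/
theorem admissibleVacuumData_eq_of_t2 :
    admissibleVacuumData X =
      {D : InitialDataSet (𝓡 3) X | (∀ [D.metric.HasLeviCivita], D.IsVacuumConstraintSolution) ∧
        ∃ (e : AFEnd X) (M : ℝ), e.IsSoleEnd ∧ e.IsStronglyAsymptoticallyFlatDR D M} := by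
  ext D
  constructor
  · rintro ⟨h1, h2⟩
    exact ⟨fun {_} ↦ h1.1, h2⟩
  · rintro ⟨h1, e, M, hsole, hSAF⟩
    exact ⟨fun {_} ↦ ⟨h1, isComplete_of_isSoleEnd_of_isStronglyAsymptoticallyFlatDR hsole hSAF⟩,
      e, M, hsole, hSAF⟩

end Complete

/-- **`IsComplete` is not load-bearing in the crux**: `WeakCosmicCensorshipMGHD` implies the same
genericity statement relative to the admissible class WITH THE COMPLETENESS CLAUSE DELETED (the
two classes coincide, `admissibleVacuumData_eq_of_t2`; the converse implication is the same
rewriting). [cite: Christodoulou1999, p. A24] -/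
theorem wccWithoutComplete_of_wcc (h : WeakCosmicCensorshipMGHD) (X : Type) [TopologicalSpace X]
    [ChartedSpace E3 X] [IsManifold (𝓡 3) ∞ X] [T2Space X] [SecondCountableTopology X]
    [ConnectedSpace X] :
    InitialDataSet.IsChristodoulouGeneric
      {D : InitialDataSet (𝓡 3) X | (∀ [D.metric.HasLeviCivita], D.IsVacuumConstraintSolution) ∧
        ∃ (e : AFEnd X) (M : ℝ), e.IsSoleEnd ∧ e.IsStronglyAsymptoticallyFlatDR D M}
      (fun D ↦ (∃ 𝒟 : VacuumCauchyDevelopment D, 𝒟.IsMaximal) ∧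
        ∀ 𝒟 : VacuumCauchyDevelopment D, 𝒟.IsMaximal →
          _root_.Summit.FinalStateConjecture.HasCompleteNullInfinity 𝒟.toCauchyDevelopment) 1 := by
  rw [← admissibleVacuumData_eq_of_t2]
  exact h X

end Summit.FinalStateConjecture.FinalStateConjecture.Theorems.WeakCosmicCensorshipMGHD.Negative

end
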